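/-
Origin: expansion seat `prover-pub-hodgecm-mc-discharge-3-0`, handover #3 14:20Z md5 ed5134ac1dcf (139 l.; NEW additive KERNEL leaf, ns HodgeCM.Model.HypCensus; 1 def `archPairPhaseHom` (explicit MonoidHom `arch J_V × arch J_W →* Sp(ℝ^{Fin m × places}²)` := `piPhaseHom (pairFrame …) (v ↦ KK.ι𝕎 …) ∘ MonoidHom.pi (v ↦ archPairPlace v ∘ archProdHom)`, data, no Prop) + 1 theorem **`isArchWeilDatum_repTransport_archWeilRep_places`** = the (J-arch) DATUM in weil-2's currency: `IsArchWeilDatum (archPairPhaseHom …) (repTransport (scaledFrame (pairScale DV DW) …) (archWeilRep … s hs))` from: `J_V = diag(tV)⊗1`, `J_W = diag(tW)⊗1` (`hVd hWd`), per-place sign frames `εV εW` / scalings `DV DW` / scalars `cV cW` with `htV htW hcc`, `wOf hw hover`, per-place Levi KAK inputs `I v : LeviKAKInput γ𝕎ᵥ (κf v) (af v)` (EXACTLY the binders of weil-2's `hasThetaMajorants_omega_pairSplitting`), a splitting `s` over `toSp` (`hs`) with `Continuous s`, `hfix : ∀ w, c • w = w`, and the sign profiles `hprofV/hprofW` (`min(p,q)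 ≤ 1` per complex place); proof = row #2's `_of_signs` with `D := kakImplementerData_leviFamily_places_reindex (pairFrame …) I`, `ϖ u := (v ↦ archPairPlace v (archProdHom u))`, `hγ := archPhaseMap_toSp_pair … (archToAdelic u.1) (archToAdelic u.2)` VERBATIM, `hdict := rfl`. 0 Prop defs, 0 records, nothing cited, MODEL-N ±0, E unchanged. EVIDENCE: hub-farm `lean check` rc 0 / 0 sorries / 0 warnings, 56 s, of the concatenation tree `ArchPlacePhaseHom` 3f042968b2dd (inlined, p188987 pending) + ArchFactor 55e596e2a0dc + ArchDatum 13e0d54cb896 + rows #1 #2 #3, imports de-vendored (`mc/pub-hodgecm-mc-discharge-3/notes/check_places_scratch.lean`, 1463 l.).) (`HOME/mc/pub-hodgecm-mc-discharge-3/stage/HodgeCM/Model/HypCensus/ArchDatumPlaces.lean`, md5 ed5134ac, 139 lines);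
landed by the gen-12 packager (p-g12) in gate run 36 as `HodgeCM/Model/HypCensus/ArchDatumPlaces.lean` (verbatim).
-/
/-
Origin: speedrun cell pub-hodgecm, MODEL-CONSTRUCTION sub-cell, discharge seat mc-discharge-3 (unit pub-hodgecm-mc-discharge-3,
seat prover-pub-hodgecm-mc-discharge-3-0), ticket D-3 = BINDER-OWNERS §1a rows 10/16/17 sub-items (c2)+(c4) of binder-2's
`archWeilRep` ((J-arch) §3(b)/(c)), assembled in weil-2's currency, 2026-08-19.
Target in PKG: `HodgeCM/Model/HypCensus/ArchDatumPlaces.lean` (NEW additive leaf; imports `ArchDatumLift` + the K-1 twins of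
`Weil1964/ArchPlacePhaseHom` (p188987) and `Weil1964/ArchDualPairThetaMajorants`).  KERNEL only: 0 records / named facts,
0 proof holes.  Checked against the hub tree by concatenation with `ArchFactor.lean` 55e596e2a0dc / `ArchDatum.lean`
13e0d54cb896 / `ArchDatumCoeff.lean` / `ArchDatumLift.lean` (imports de-vendored), farm rc 0.
-/
import Summits.HodgeConjecture.HodgeCM.Model.HypCensus.ArchDatumLift
import Literature.NumberTheory.Weil1964.ArchPlacePhaseHom
import Literature.NumberTheory.Weil1964.ArchDualPairThetaMajorants

/-!
# Census kit (rows A12/A34), junction (J-arch): the archimedean Weil datum of `archWeilRep` in weil-2's currency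

`ArchDatumCoeff` / `ArchDatumLift` give (w1), (w2′) and `IsArchWeilDatum ι𝕎 (repTransport e′ archWeilRep)` for ANY `KAK`
implementer data `D`, dictionary `hγ` and phase homomorphism `ι𝕎`.  This leaf plugs in THE data of the tree:

* `D := kakImplementerData_leviFamily_places_reindex (pairFrame …) I` from per-place Levi-form `KAK` inputs
  `I v : LeviKAKInput γ𝕎ᵥ κ_v a_v` of Konno–Konno's real pairs (`Weil1964/ArchLeviKAKInput`: `.junction`, `.junctionSwap`,
  `.junctionCompact`, chosen from SIGN FACTS by `ArchDualPairThetaMajorants.nonempty_anyLeviKAKInput_of_signs_*`);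
* `ϖ u := (v ↦ archPairPlace v (x̃, ỹ))`, `(x̃, ỹ) = archProdHom u` (`ArchFollandDualPair.archPairPlace`);
* the frame `e′ := scaledFrame (pairScale D_V D_W)` and the dictionary `hγ := archPhaseMap_toSp_pair`
  (`ArchDualPairThetaMajorants`) — verbatim;
* `ι𝕎 := (piPhaseHom (pairFrame …) (v ↦ ι𝕎 (P v) (Q v) (R v) (S v))).comp ϖ` (`Weil1964/ArchPlacePhaseHom`), `hdict` by `rfl`;
* the positive-character input from the sign profiles `hprofV`, `hprofW` (`UnitaryGroup.mulPos_eq_one_arch_diagonal`).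

Result **`isArchWeilDatum_repTransport_archWeilRep_places`**: for `J_V = diag(t_V) ⊗ 1`, `J_W = diag(t_W) ⊗ 1` over a CM-type
quadratic extension, any splitting `s` over `toSp` that is CONTINUOUS, per-place sign frames / adapted scalings / Levi `KAK` inputs
as in weil-2's `hasThetaMajorants_omega_pairSplitting`, and the rank profiles `min(p,q) ≤ 1` place by place:
`IsArchWeilDatum ι𝕎 (repTransport e_D (archWeilRep … s hs))` on `G_∞ = U(J_V)(E⊗ℝ) × U(J_W)(E⊗ℝ)` — the (J-arch) datum of
BINDER-TRIAGE §50.2 with NO further hypothesis on `archWeilRep`.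

Nothing here is a claim of PerL/QW8. [Folland1989, §4.2, the Schur remark p. 156] is the provenance of the argument.
-/

set_option autoImplicit false

noncomputable section

open NumberField NumberField.InfinitePlace IsDedekindDomain MeasureTheory
open scoped Matrix
open scoped Kronecker Classical TensorProduct
open Literature.NumberTheory.Automorphic Literature.NumberTheory.Automorphic.UnitaryGroup Literature.NumberTheory.Weil1964
open Literature.RepresentationTheory.HeisenbergGroup (polar Heisenberg symplecticGroup ofSymplectic)
open Literature.RepresentationTheory.KonnoKonno2007 Literature.RepresentationTheory.KonnoKonno2007.RealDualPair
open Literature.NumberTheory.GelbartRogawski1991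
open Literature.Analysis.SegalBargmann

namespace HodgeCM.Model.HypCensus

section Places

variable {F : Type} [Field F] [NumberField F] (E : Type) [Field E] [NumberField E] [Algebra F E] (c : E ≃ₐ[F] E)
  (N M : ℕ) {m : ℕ} (e : Fin N × Fin M ≃ Fin m) (hc : c ≠ 1)
  (wOf : {v : InfinitePlace F // v.IsReal} → {w : InfinitePlace E // w.IsComplex})
  (hw : ∀ v, c • (wOf v).1 = (wOf v).1) (hover : ∀ v, (wOf v).1.comap (algebraMap F E) = v.1)
  (tV : Fin N → F) (tW : Fin M → F) {JV : Matrix (Fin N) (Fin N) E} {JW : Matrix (Fin M) (Fin M) E}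
  (hJV : JV = (Matrix.diagonal tV).map (algebraMap F E)) (hJW : JW = (Matrix.diagonal tW).map (algebraMap F E))
  {P Q R S : {v : InfinitePlace F // v.IsReal} → Type} [∀ v, Fintype (P v)] [∀ v, DecidableEq (P v)]
  [∀ v, Fintype (Q v)] [∀ v, DecidableEq (Q v)] [∀ v, Fintype (R v)] [∀ v, DecidableEq (R v)]
  [∀ v, Fintype (S v)] [∀ v, DecidableEq (S v)]
  (εV : ∀ v, Fin N ≃ P v ⊕ Q v) (εW : ∀ v, Fin M ≃ R v ⊕ S v)
  {DV : {v : InfinitePlace F // v.IsReal} → Fin N → ℝ} {DW : {v : InfinitePlace F // v.IsReal} → Fin M → ℝ}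
  (hDV0 : ∀ v i, DV v i ≠ 0) (hDW0 : ∀ v j, DW v j ≠ 0) {cV cW : {v : InfinitePlace F // v.IsReal} → ℝ}
  (hcV : ∀ v, cV v ≠ 0) (hcW : ∀ v, cW v ≠ 0)
  (htV : ∀ v i, embedding_of_isReal v.2 (tV i) = cV v * signOf (εV v i) * DV v i ^ 2)
  (htW : ∀ v j, embedding_of_isReal v.2 (tW j) = cW v * signOf (εW v j) * DW v j ^ 2)
  [IsTotallyReal F] [Algebra.IsQuadraticExtension F E] {δ : E} (hcδ : c δ = -δ) (hδ : δ ≠ 0) {d : F}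
  (hd : δ * δ = algebraMap F E d)

/-- **The phase homomorphism of the archimedean pair group** in the scaled Folland frame: the product over the real places
of Konno–Konno's `ι𝕎 : U(P_v,Q_v) × U(R_v,S_v) →* Sp`, relabelled by `pairFrame`, along
`u ↦ (archPairPlace v (x̃, ỹ))_v` (`piPhaseHom` of `Weil1964/ArchPlacePhaseHom`). -/
def archPairPhaseHom :
    UnitaryGroup.arch F E c N JV × UnitaryGroup.arch F E c M JW →*
      symplecticGroup (polar (dotPairing (Fin m × {v : InfinitePlace F // v.IsReal}))) :=
  (piPhaseHom (fun v => pairFrame (P v) (Q v) (R v) (S v) e (εV v) (εW v))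
      (fun v => ι𝕎 (P v) (Q v) (R v) (S v))).comp
    (MonoidHom.pi fun v =>
      (archPairPlace E c N M hc wOf hw hover tV tW hJV hJW εV εW hDV0 hDW0 hcV hcW htV htW v).comp
        (archProdHom F E c N M JV JW))

/-- **The (J-arch) datum in weil-2's currency.**  For `J_V = diag(t_V) ⊗ 1`, `J_W = diag(t_W) ⊗ 1`, a continuous splitting
`s` of the GR91 pair over `toSp`, per-place sign frames `ε_V, ε_W` / adapted scalings `D_V, D_W` / scalars `c_V c_W = im σ(δ)`,
per-place Levi-form `KAK` inputs `I v`, `c ≠ 1` fixing every infinite place, and the rank profiles «`σ_v(t_V)` has at most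
one negative entry or is negative everywhere» (and likewise `t_W`) at every complex place:
`IsArchWeilDatum (archPairPhaseHom …) (repTransport e_D (archWeilRep … s hs))` — (w1), (w2), (w2′) with NO further
hypothesis on `archWeilRep`. [Folland1989, §4.2, the Schur remark p. 156; Weil1964, Chap. III n° 37–39] -/
theorem isArchWeilDatum_repTransport_archWeilRep_places (hcc : ∀ v, cV v * cW v = ((wOf v).1.embedding δ).im)
    (hVd : IsUnit (Matrix.diagonal tV).det) (hWd : IsUnit (Matrix.diagonal tW).det)
    {Kk Pa : {v : InfinitePlace F // v.IsReal} → Type*} [∀ v, TopologicalSpace (Kk v)]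
    [∀ v, TopologicalSpace (Pa v)] {κf : ∀ v, Kk v → Ginf (P v) (Q v) (R v) (S v)}
    {af : ∀ v, Pa v → Ginf (P v) (Q v) (R v) (S v)}
    (I : ∀ v, LeviKAKInput
      (fun g : Ginf (P v) (Q v) (R v) (S v) =>
        (⇑((ι𝕎 (P v) (Q v) (R v) (S v) g).1 :
          ((DPIdx (P v) (Q v) (R v) (S v) → ℝ) × (DPIdx (P v) (Q v) (R v) (S v) → ℝ)) ≃ₗ[ℝ]
            ((DPIdx (P v) (Q v) (R v) (S v) → ℝ) × (DPIdx (P v) (Q v) (R v) (S v) → ℝ))) :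
          PhaseMap (DPIdx (P v) (Q v) (R v) (S v))))
      (κf v) (af v))
    (s : UnitaryGroup.adelicPair F E c N M JV JW →*
      adelicMpCont F (Fin m) (UnitaryDualPair.adelicGram F e (Matrix.diagonal tV) (Matrix.diagonal tW)))
    (hs : ∀ g, adelicMpCont.proj F (Fin m) (UnitaryDualPair.adelicGram F e (Matrix.diagonal tV) (Matrix.diagonal tW)) (s g) =
      UnitaryDualPair.toSp F E c N M e JV JW hcδ hδ hd (Matrix.isSymm_diagonal tV) (Matrix.isSymm_diagonal tW) hJV hJW g)
    (hscont : Continuous s) (hfix : ∀ w : InfinitePlace E, c • w = w)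
    (hprofV : ∀ w : {w : InfinitePlace E // w.IsComplex},
      (∃ i₀, ∀ i, i ≠ i₀ → 0 < UnitaryGroup.realPlaceMap F E c w (hfix w.1) hc (tV i)) ∨
        ∀ i, UnitaryGroup.realPlaceMap F E c w (hfix w.1) hc (tV i) < 0)
    (hprofW : ∀ w : {w : InfinitePlace E // w.IsComplex},
      (∃ j₀, ∀ j, j ≠ j₀ → 0 < UnitaryGroup.realPlaceMap F E c w (hfix w.1) hc (tW j)) ∨
        ∀ j, UnitaryGroup.realPlaceMap F E c w (hfix w.1) hc (tW j) < 0) :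
    IsArchWeilDatum
      (archPairPhaseHom E c N M e hc wOf hw hover tV tW hJV hJW εV εW hDV0 hDW0 hcV hcW htV htW)
      (repTransport (scaledFrame F (Fin m) (pairScale N M (e := e) DV DW) (pairScale_ne_zero N M hDV0 hDW0))
        (archWeilRep F E c N M JV JW hcδ hδ hd (Matrix.isSymm_diagonal tV) (Matrix.isSymm_diagonal tW) hVd hWd hJV hJW e
          s hs)) :=
  isArchWeilDatum_repTransport_archWeilRep_of_signs F E c N M JV JW hcδ hδ hd hVd hWd hJV hJW e s hs
    ((UnitaryDualPair.continuous_pairSplitting F E c N M e JV JW hscont).comp (continuous_archProdHom F E c N M JV JW))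
    (scaledFrame F (Fin m) (pairScale N M (e := e) DV DW) (pairScale_ne_zero N M hDV0 hDW0))
    (isUnit_archMat_of_isUnit _ (UnitaryDualPair.isUnit_adelicGram F e hVd hWd))
    (kakImplementerData_leviFamily_places_reindex (fun v => pairFrame (P v) (Q v) (R v) (S v) e (εV v) (εW v)) I)
    (fun u v => archPairPlace E c N M hc wOf hw hover tV tW hJV hJW εV εW hDV0 hDW0 hcV hcW htV htW v
      (archProdHom F E c N M JV JW u))
    (continuous_pi fun v =>
      (continuous_archPairPlace E c N M hc wOf hw hover tV tW hJV hJW εV εW hDV0 hDW0 hcV hcW htV htW v).comp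
        (continuous_archProdHom F E c N M JV JW))
    (fun u pq => congrFun (archPhaseMap_toSp_pair E c N M e hc wOf hw hover tV tW hJV hJW εV εW hDV0 hDW0 hcV hcW htV
      htW hcδ hδ hd (Matrix.isSymm_diagonal tV) (Matrix.isSymm_diagonal tW) hcc _
        (UnitaryGroup.archToAdelic F E c N JV u.1) (UnitaryGroup.archToAdelic F E c M JW u.2)) pq)
    (archPairPhaseHom E c N M e hc wOf hw hover tV tW hJV hJW εV εW hDV0 hDW0 hcV hcW htV htW) (fun _ _ => rfl) hc
    hfix hprofV hprofW

end Places

end HodgeCM.Model.HypCensus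

end
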